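import Literature.AnabelianGeometry.SemiGraphs.TemperedOriginSchemaNegative
import Literature.AnabelianGeometry.SemiGraphs.TemperedAnabelianMorphisms
import Literature.AnabelianGeometry.SemiGraphs.TemperedCurveGroupLevelDataNonVacuity2
import Literature.AnabelianGeometry.SemiGraphs.OncePuncturedTemperedGroupPadicWitness
import HarnessLib

/-!
# [SemiAnbd] §6: the ORIGIN certificates `TemperedOrigin`, `TemperedMorphismOrigin`, `TemperedPiOrigin`
# inhabited AT THE GENUINE MODELS, and the §6 statements evaluated there (non-vacuity)

Mochizuki, *Semi-graphs of anabelioids*, Publ. RIMS **42** (2006) [SemiAnbd], §6: Lemma 6.1 (ii)(iii)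
p. 69, Lemma 6.3 (ii)(iii) p. 70, Theorem 6.4 pp. 70–71, Theorem 6.5 pp. 71–72, Theorem 6.6 p. 72,
Theorem 6.8 pp. 74–75 [cite: MochizukiSemiAnbd2006, §6 pp.69-75]; Example 3.10 pp. 43–45
[cite: MochizukiSemiAnbd2006, Ex 3.10 pp.43-45].

PROOF-ONLY file (abc-iut cell, layer L3, NV lane; seat abc-iut-w6-d055, row «NV-L3 TemperedOrigin /
TemperedPiOrigin / TemperedMorphismOrigin inhabited at the GENUINE model», abc-iut-L3-lead (gen 5) α38 (2);
theorems only — no `def`, no `instance`, no new named fact).  The three ORIGIN certificates of the §6 /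
Ex. 3.10 interfaces — `TemperedOrigin p` (`TemperedOrigin.lean`), `TemperedMorphismOrigin p`
(`TemperedAnabelianMorphisms.lean`), `TemperedPiOrigin K` (`TemperedCurves.lean`) — had no `Nonempty`/`∃`
producer in abc-iut-w4-d098's INHABITATION-CENSUS-L3 v2 (b6b2ecaaf2382289).  Here they are inhabited by the
PRINCIPAL certificates of the cell's GENUINE kernel models, and the printed §6 statements `…Holds Ω` are
EVALUATED at those certificates:

* `TemperedOrigin` / `TemperedMorphismOrigin` at abc-iut-w5-d040's §6 datum
  `exists_temperedCurve_groupLevelData_genuine` (`TemperedCurveGroupLevelDataNonVacuity2.lean`, p425993: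
  `K = ℚ_p`, `Π^temp = G_{ℚ_p} × F̂₂` COMPACT, `Δ^temp` nonabelian slim, a cusp, `GroupLevelData`
  unconditional): the principal origin `Ω_X := ⟨(· = X)⟩` certifies exactly that `X`;
  - `ProfiniteNormalizersHolds Ω_X` (Lem. 6.1 (ii)(iii)) — HOLDS (`Π^temp` compact ⇒ `Π^temp → Π̂` onto;
    abc-iut-f-056's `profiniteNormalizers_of_surjective`);
  - `DenseSubgroupsHolds Ω_X` (Lem. 6.3 (ii)(iii)) — HOLDS, by the generic
    `isDFGType_iff_isDOFType_of_bijective`: for a continuous BIJECTIVE `ι : F → F̂` from a compact group to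
    a Hausdorff one, DFG-type ⟺ DOF-type (open subgroups have finite index, finite quotients are finitely
    generated, `ι` is a homeomorphism), and the conjugator clauses are trivial when `ι` is onto;
  - `ProfiniteOuterIsoLiftsHolds Ω_X` (Thm. 6.6) — HOLDS (`profiniteOuterIsoLifts_of_compactSpace`: lift
    `β := ι_Y⁻¹ ∘ α̂ ∘ ι_X`, unique up to `Inn`);
  - `TemperedDecompositionGroupsHolds Ω_X` (Thm. 6.5 (i)(ii)(iv)) ⟺ the five conjuncts AT `X`
    (`temperedDecompositionGroupsHolds_principal_iff`) — these are abc-iut-w5-d040's NV3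
    (`exists_temperedCurve_thm65_package_genuine`, p427727, olean pending at filing time: one `obtain` away);
  - `CuspidalAbsolutenessHolds Ω_X` (Thm. 6.5 (iii)) ⟺ `X.IsoPreservesCuspidalDecomp X`
    (`cuspidalAbsolutenessHolds_principal_iff`) — NOT claimed at the model (w5-d040: `id × (a ↔ b)` moves
    `cl η⟨a⟩`; the model is not a curve);
  - the three certificates proper to `TemperedMorphismOrigin` (dominant morphisms, `DLoc_K(X_K)`, arithmetic
    flags) are EMPTY at the model — HONEST: a product group with one formal cusp is not a curve, so no
    dominant-morphism / `DLoc` / arithmetic-adjective datum is certifiable there; Thm. 6.4 / 6.8 `…Holds` are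
    then vacuous and are recorded as such, not as evidence.
* `TemperedPiOrigin ℚ_[p]` at abc-iut-w5-d218's once-punctured `p`-adic model
  `OncePuncturedTemperedGroup.nonempty_model_padic` (`Π = (F̂₂ ×_Ẑ ℤ) × G_{ℚ_p}`, genuine `G_{ℚ_p}`, `Δ̂ ≅ F̂₂`
  profinite free on two generators): the principal certificate `IsTateOrigin := (· = D)`,
  `IsOfGeometricOrigin := (· = D.toTemperedArithmeticGroup)` (the structure's one axiom holds by `rfl`).

HONEST FRAMING.  A principal certificate at a kernel MODEL is consistency / non-vacuity evidence for the
typed §6 package: it shows which printed statements the interface axioms + the model already force and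
which ones carry content (Thm. 6.5 (iii) fails at a non-curve).  It is NOT André's `π₁^temp` of a
hyperbolic curve (the intended certificate), which no seat has constructed; nothing of [SemiAnbd] is
asserted or denied for curves; typed ≠ proved; no side is taken on [IUTchIII] Cor. 3.12.
-/

noncomputable section

namespace Literature.AnabelianGeometry.SemiGraphs

open scoped Pointwise
open _root_.Topology
open Literature.AlgebraicGeometry.Frobenioids (IsSlimGroup)

universe u v

/-! ### Generic: DFG-type ⟺ DOF-type along a continuous bijection from a compact group to a T₂ group -/

section Generic

variable {F : Type u} {Fhat : Type v} [Group F] [TopologicalSpace F] [IsTopologicalGroup F]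
  [CompactSpace F] [Group Fhat] [TopologicalSpace Fhat] [T2Space Fhat]

/-- An open subgroup of a compact group has finite index (discrete compact quotient).
[cite: MochizukiSemiAnbd2006, Def 6.2(ii) p.70] -/
theorem finiteIndex_of_isOpen_compact (U : Subgroup F) (hU : IsOpen (U : Set F)) : U.FiniteIndex := by
  haveI : DiscreteTopology (F ⧸ U) := QuotientGroup.discreteTopology_iff.mpr hU
  haveI : Finite (F ⧸ U) := finite_of_compact_of_discrete
  exact Subgroup.finiteIndex_of_finite_quotient

/-- In a compact group the image of any subgroup in the quotient by an open normal subgroup is finitely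
generated (the quotient is finite). [cite: MochizukiSemiAnbd2006, Def 6.2(i) pp.69-70] -/
theorem fg_map_mk_of_isOpen (H : Subgroup F) (J : OpenNormalSubgroup F) :
    (H.map (QuotientGroup.mk' J.toSubgroup)).FG := by
  haveI : J.toSubgroup.FiniteIndex := finiteIndex_of_isOpen_compact J.toSubgroup J.isOpen'
  haveI : Finite (F ⧸ J.toSubgroup) := Subgroup.finite_quotient_of_finiteIndex
  refine ⟨(Set.toFinite (H.map (QuotientGroup.mk' J.toSubgroup) : Set (F ⧸ J.toSubgroup))).toFinset, ?_⟩
  rw [Set.Finite.coe_toFinset, Subgroup.closure_eq]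

/-- **Lemma 6.3 (ii) in the regime `F → F̂` bijective** ([SemiAnbd] p. 70: "a subgroup `H ⊆ F` is of
DFG-type if and only if it is of DOF-type"): for a continuous BIJECTIVE homomorphism `ι : F → F̂` from a
compact group to a Hausdorff group (so `ι` is a homeomorphism), DFG-type and DOF-type coincide for every
`H ≤ F`.  (The printed case — `F` a non-compact tempered group, `ι` a proper dense injection — is NOT
this one; consistency regime only.) [cite: MochizukiSemiAnbd2006, Lem 6.3(ii) p.70] -/
theorem isDFGType_iff_isDOFType_of_bijective (ι : F →ₜ* Fhat) (hι : Function.Bijective ι)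
    (H : Subgroup F) : IsDFGType ι H ↔ IsDOFType H := by
  -- `ι` as a homeomorphism
  let e : F ≃ₜ Fhat := Continuous.homeoOfEquivCompactToT2 (f := Equiv.ofBijective ι hι) ι.continuous
  have he : ∀ x, e x = ι x := fun _ => rfl
  have himage : ∀ s : Set F, (ι : F → Fhat) '' s = e '' s := fun s => by
    ext y; simp [he]
  constructor
  · rintro ⟨⟨U, hUo, hcl⟩, -⟩
    refine ⟨U.comap ι.toMonoidHom, ?_, ?_, ?_⟩
    · exact hUo.preimage ι.continuous
    · exact finiteIndex_of_isOpen_compact _ (hUo.preimage ι.continuous)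
    · -- `closure H = ι⁻¹ U` since `ι '' closure H = closure (ι '' H) = U`
      have h1 : e '' closure (H : Set F) = (U : Set Fhat) := by
        rw [e.image_closure, ← himage, hcl]
      have h2 : closure (H : Set F) = e ⁻¹' (U : Set Fhat) := by
        rw [← h1, e.preimage_image]
      rw [h2]
      rfl
  · rintro ⟨U, hUo, -, hcl⟩
    refine ⟨⟨U.map ι.toMonoidHom, ?_, ?_⟩, fun J => fg_map_mk_of_isOpen H J⟩
    · have : ((U.map ι.toMonoidHom : Subgroup Fhat) : Set Fhat) = e '' (U : Set F) := by
        rw [Subgroup.coe_map, ← himage]; rfl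
      rw [this]
      exact e.isOpenMap _ hUo
    · rw [himage, ← e.image_closure, hcl, Subgroup.coe_map, ← himage]
      rfl

end Generic

namespace TemperedCurve

variable {p : ℕ} [Fact p.Prime]

/-! ### The regime `Π^temp` compact: `Π^temp → Π̂` is an isomorphism of topological groups -/

/-- If `Π^temp_{X_K}` is compact then the natural injection `Π^temp_{X_K} ↪ Π_{X_K}` into the profinite
completion is ONTO (dense compact image in a Hausdorff space). The printed `Π^temp` is never compact; this is
the consistency regime of the cell's compact models. [cite: MochizukiSemiAnbd2006, §6 p.69] -/
theorem toHat_surjective_of_compactSpace (X : TemperedCurve p) [CompactSpace X.PiTemp] :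
    Function.Surjective X.toHat := by
  haveI := X.isProfiniteCompletion_toHat.t2Space
  have hclosed : IsClosed (Set.range X.toHat) := (isCompact_range X.toHat.continuous).isClosed
  have hdense : closure (Set.range X.toHat) = Set.univ := X.isProfiniteCompletion_toHat.denseRange.closure_range
  rw [hclosed.closure_eq] at hdense
  exact Set.range_eq_univ.mp hdense

/-- For compact `Π^temp_{X_K}`, `Π^temp_{X_K} → Π_{X_K}` is an isomorphism of topological groups (stated as
the existence of a `≃ₜ*` agreeing with `toHat`; no definition is introduced). [cite: MochizukiSemiAnbd2006, §6 p.69] -/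
theorem exists_continuousMulEquiv_eq_toHat (X : TemperedCurve p) [CompactSpace X.PiTemp] :
    ∃ e : X.PiTemp ≃ₜ* X.PiHat, ∀ g, e g = X.toHat g := by
  haveI := X.isProfiniteCompletion_toHat.t2Space
  let f : X.PiTemp ≃ X.PiHat :=
    Equiv.ofBijective X.toHat ⟨X.toHat_injective, X.toHat_surjective_of_compactSpace⟩
  let h : X.PiTemp ≃ₜ X.PiHat := Continuous.homeoOfEquivCompactToT2 (f := f) X.toHat.continuous
  exact ⟨{ h with map_mul' := fun a b => map_mul X.toHat a b }, fun _ => rfl⟩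

/-- For compact `Π^temp_{X_K}` the image of `Δ^temp_X` in `Π_{X_K}` is closed (compact image in a Hausdorff
group). [cite: MochizukiSemiAnbd2006, §6 p.69] -/
theorem isClosed_map_deltaTemp_of_compactSpace (X : TemperedCurve p) [CompactSpace X.PiTemp] :
    IsClosed ((X.DeltaTemp.map X.toHat.toMonoidHom : Subgroup X.PiHat) : Set X.PiHat) := by
  haveI := X.isProfiniteCompletion_toHat.t2Space
  rw [Subgroup.coe_map]
  exact ((X.isClosed_deltaTemp.isCompact).image X.toHat.continuous).isClosed

/-- For compact `Π^temp_{X_K}` the restriction `Δ^temp_X → Δ_X` is bijective. [cite: MochizukiSemiAnbd2006, §6 p.69] -/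
theorem deltaToHat_bijective_of_compactSpace (X : TemperedCurve p) [CompactSpace X.PiTemp] :
    Function.Bijective X.deltaToHat := by
  refine ⟨fun a b h => Subtype.ext (X.toHat_injective (congrArg Subtype.val h)), fun y => ?_⟩
  have hle : X.DeltaHat ≤ X.DeltaTemp.map X.toHat.toMonoidHom :=
    Subgroup.topologicalClosure_minimal _ le_rfl X.isClosed_map_deltaTemp_of_compactSpace
  obtain ⟨g, hg, hgy⟩ := hle y.2
  exact ⟨⟨g, hg⟩, Subtype.ext hgy⟩

/-! ### Lemma 6.1 (ii)(iii), Lemma 6.3 (ii)(iii), Theorem 6.6 in the compact regime -/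

/-- **Lem. 6.1 (ii)(iii) for compact `Π^temp`** (`N_{Δ_X}(Δ^temp_X) = Δ^temp_X`, `N_{Π}(Π^temp) = Π^temp`):
both normalizer clauses hold (abc-iut-f-056's `profiniteNormalizers_of_surjective`).
[cite: MochizukiSemiAnbd2006, Lem 6.1(ii)-(iii) p.69] -/
theorem profiniteNormalizers_of_compactSpace (X : TemperedCurve p) [CompactSpace X.PiTemp] :
    X.DeltaTempNormallyTerminal ∧ X.PiTempNormallyTerminal :=
  X.profiniteNormalizers_of_surjective X.toHat_surjective_of_compactSpace
    X.isClosed_map_deltaTemp_of_compactSpace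

/-- **Lem. 6.3 (ii), case `F = Π^temp_{X_K}`, for compact `Π^temp`**: DFG-type ⟺ DOF-type for every
subgroup. [cite: MochizukiSemiAnbd2006, Lem 6.3(ii) p.70] -/
theorem piTempDFGIffDOF_of_compactSpace (X : TemperedCurve p) [CompactSpace X.PiTemp] :
    X.PiTempDFGIffDOF := by
  haveI := X.isProfiniteCompletion_toHat.t2Space
  exact fun H => isDFGType_iff_isDOFType_of_bijective X.toHat
    ⟨X.toHat_injective, X.toHat_surjective_of_compactSpace⟩ H

/-- **Lem. 6.3 (ii), case `F = Δ^temp_X`, for compact `Π^temp`**: DFG-type ⟺ DOF-type for every subgroup of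
`Δ^temp_X` (closed in `Π^temp`, hence compact; `Δ^temp_X → Δ_X` bijective).
[cite: MochizukiSemiAnbd2006, Lem 6.3(ii) p.70] -/
theorem deltaTempDFGIffDOF_of_compactSpace (X : TemperedCurve p) [CompactSpace X.PiTemp] :
    X.DeltaTempDFGIffDOF := by
  haveI := X.isProfiniteCompletion_toHat.t2Space
  haveI : CompactSpace X.DeltaTemp := isCompact_iff_compactSpace.mp X.isClosed_deltaTemp.isCompact
  exact fun H => isDFGType_iff_isDOFType_of_bijective X.deltaToHat X.deltaToHat_bijective_of_compactSpace H

/-- **Lem. 6.3 (iii), case `F = Π^temp_{X_K}`, for compact `Π^temp`**: every conjugator `f ∈ Π̂` lies in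
`Π^temp` — because `Π^temp → Π̂` is onto. [cite: MochizukiSemiAnbd2006, Lem 6.3(iii) p.70] -/
theorem piTempDenseDOFConjugator_of_compactSpace (X : TemperedCurve p) [CompactSpace X.PiTemp] :
    X.PiTempDenseDOFConjugator := by
  intro F₁ F₂ _ _ _ _ f _
  obtain ⟨g, hg⟩ := X.toHat_surjective_of_compactSpace (ConjAct.ofConjAct f)
  exact ⟨g, hg⟩

/-- **Lem. 6.3 (iii), case `F = Δ^temp_X`, for compact `Π^temp`**: every conjugator `f ∈ Δ_X` lies in
`Δ^temp_X` — because `Δ^temp_X → Δ_X` is onto. [cite: MochizukiSemiAnbd2006, Lem 6.3(iii) p.70] -/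
theorem deltaTempDenseDOFConjugator_of_compactSpace (X : TemperedCurve p) [CompactSpace X.PiTemp] :
    X.DeltaTempDenseDOFConjugator := by
  intro F₁ F₂ _ _ _ _ f _
  obtain ⟨g, hg⟩ := X.deltaToHat_bijective_of_compactSpace.2 (ConjAct.ofConjAct f)
  exact ⟨g, hg⟩

/-- **Thm. 6.6 between data with compact `Π^temp`** ("every outer isomorphism `Π_{X_K} ≅ Π_{Y_L}` arises from
a unique outer isomorphism `Π^temp_{X_K} ≅ Π^temp_{Y_L}`"): with `ι_X`, `ι_Y` isomorphisms, `α̂` lifts to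
`β := ι_Y⁻¹ ∘ α̂ ∘ ι_X`, and two lifts differ by an inner automorphism of `Π^temp_{Y_L}`.
[cite: MochizukiSemiAnbd2006, Thm 6.6 p.72] -/
theorem profiniteOuterIsoLifts_of_compactSpace (X Y : TemperedCurve p) [CompactSpace X.PiTemp]
    [CompactSpace Y.PiTemp] : X.ProfiniteOuterIsoLifts Y := by
  obtain ⟨eX, heX⟩ := X.exists_continuousMulEquiv_eq_toHat
  obtain ⟨eY, heY⟩ := Y.exists_continuousMulEquiv_eq_toHat
  intro αhat
  refine ⟨⟨eX.trans (αhat.trans eY.symm), 1, fun g => ?_⟩, ?_⟩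
  · rw [one_mul, inv_one, mul_one, ← heY, ← heX]
    change αhat (eX g) = eY (eY.symm (αhat (eX g)))
    rw [ContinuousMulEquiv.apply_symm_apply]
  · rintro β β' ⟨c, hc⟩ ⟨c', hc'⟩
    refine ⟨eY.symm (c'⁻¹ * c), fun g => Y.toHat_injective ?_⟩
    have e : c * Y.toHat (β g) * c⁻¹ = c' * Y.toHat (β' g) * c'⁻¹ := (hc g).symm.trans (hc' g)
    have hy : Y.toHat (eY.symm (c'⁻¹ * c)) = c'⁻¹ * c := by
      rw [← heY, ContinuousMulEquiv.apply_symm_apply]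
    rw [map_mul, map_mul, map_inv, hy]
    calc Y.toHat (β' g) = c'⁻¹ * (c' * Y.toHat (β' g) * c'⁻¹) * c' := by group
      _ = c'⁻¹ * (c * Y.toHat (β g) * c⁻¹) * c' := by rw [e]
      _ = c'⁻¹ * c * Y.toHat (β g) * (c'⁻¹ * c)⁻¹ := by group

/-! ### Principal origin certificates: the §6 statements reduce to their instances at the certified datum -/

/-- At the PRINCIPAL certificate `Ω_X := ⟨(· = X)⟩` ("exactly `X` is a hyperbolic-curve datum"),
`TemperedDecompositionGroupsHolds` (Thm. 6.5 (i)(ii)(iv)) is the conjunction of its five clauses AT `X`.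
[cite: MochizukiSemiAnbd2006, Thm 6.5 pp.71-72] -/
theorem temperedDecompositionGroupsHolds_principal_iff (X : TemperedCurve p) :
    (⟨fun Y => Y = X⟩ : TemperedOrigin p).TemperedDecompositionGroupsHolds ↔
      X.DecompDeterminesPoint ∧ X.InertiaDeterminesCusp ∧ X.DecompCommensurablyTerminal ∧
        X.DecompEqCommensuratorOfOpenInertia ∧ X.NoncuspidalNotLeCuspidal :=
  ⟨fun h => h X rfl, fun h => by rintro Y (rfl : Y = X); exact h⟩

/-- At the principal certificate `Ω_X`, `CuspidalAbsolutenessHolds` (Thm. 6.5 (iii)) is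
`X.IsoPreservesCuspidalDecomp X` (automorphisms of `Π^temp_{X_K}` preserve cuspidal decomposition groups).
[cite: MochizukiSemiAnbd2006, Thm 6.5(iii) p.72] -/
theorem cuspidalAbsolutenessHolds_principal_iff (X : TemperedCurve p) :
    (⟨fun Y => Y = X⟩ : TemperedOrigin p).CuspidalAbsolutenessHolds ↔ X.IsoPreservesCuspidalDecomp X :=
  ⟨fun h => h X X rfl rfl, fun h => by rintro Y Z rfl rfl; exact h⟩

/-- At the principal certificate `Ω_X` of a datum with COMPACT `Π^temp`, Lem. 6.1 (ii)(iii), Lem. 6.3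
(ii)(iii) and Thm. 6.6 as typed all HOLD. [cite: MochizukiSemiAnbd2006, §6 pp.69-72] -/
theorem holds_principal_of_compactSpace (X : TemperedCurve p) [CompactSpace X.PiTemp] :
    (⟨fun Y => Y = X⟩ : TemperedOrigin p).ProfiniteNormalizersHolds ∧
    (⟨fun Y => Y = X⟩ : TemperedOrigin p).DenseSubgroupsHolds ∧
    (⟨fun Y => Y = X⟩ : TemperedOrigin p).ProfiniteOuterIsoLiftsHolds := by
  refine ⟨?_, ?_, ?_⟩
  · rintro Y (rfl : Y = X)
    exact Y.profiniteNormalizers_of_compactSpace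
  · rintro Y (rfl : Y = X)
    exact ⟨Y.piTempDFGIffDOF_of_compactSpace, Y.deltaTempDFGIffDOF_of_compactSpace,
      Y.piTempDenseDOFConjugator_of_compactSpace, Y.deltaTempDenseDOFConjugator_of_compactSpace⟩
  · rintro Y Z rfl rfl
    exact profiniteOuterIsoLifts_of_compactSpace _ _

end TemperedCurve

/-! ### The GENUINE §6 model of abc-iut-w5-d040: `TemperedOrigin` and `TemperedMorphismOrigin` inhabited -/

/-- **`TemperedOrigin p` is inhabited AT THE GENUINE MODEL** (abc-iut-w5-d040,
`exists_temperedCurve_groupLevelData_genuine`: `K = ℚ_p`, `aug` onto `G_{ℚ_p}`, `GroupLevelData` unconditional,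
a cusp, `Δ^temp` nonabelian, `Π^temp` and `Δ^temp` slim, `Π^temp` compact): the PRINCIPAL certificate
`Ω := ⟨(· = X)⟩` certifies exactly that `X`, and AT IT Lem. 6.1 (ii)(iii) (`ProfiniteNormalizersHolds`),
Lem. 6.3 (ii)(iii) (`DenseSubgroupsHolds`) and Thm. 6.6 (`ProfiniteOuterIsoLiftsHolds`) HOLD, while
Thm. 6.5 (i)(ii)(iv) / (iii) reduce to their clauses at `X` (the former = abc-iut-w5-d040's NV3 package
`exists_temperedCurve_thm65_package_genuine`; the latter NOT claimed — the model is not a curve).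
Non-vacuity evidence for the typed §6 package; not André's `π₁^temp`. [cite: MochizukiSemiAnbd2006, §6 pp.69-72] -/
theorem TemperedOrigin.exists_principal_genuine (p : ℕ) [Fact p.Prime] :
    ∃ (X : TemperedCurve p) (Ω : TemperedOrigin p),
      (∀ Y, Ω.IsHyperbolicCurveOrigin Y ↔ Y = X) ∧
      -- the genuine model (clause list of p425993, re-exported)
      X.K = ⊥ ∧ Function.Surjective X.aug ∧ Nonempty X.GroupLevelData ∧ (∃ x : X.Pt, X.IsCusp x) ∧
      (∃ g ∈ X.DeltaTemp, ∃ h ∈ X.DeltaTemp, g * h ≠ h * g) ∧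
      IsSlimGroup X.PiTemp ∧ IsSlimGroup X.DeltaTemp ∧ CompactSpace X.PiTemp ∧
      -- §6 at Ω
      Ω.ProfiniteNormalizersHolds ∧ Ω.DenseSubgroupsHolds ∧ Ω.ProfiniteOuterIsoLiftsHolds ∧
      (Ω.TemperedDecompositionGroupsHolds ↔
        X.DecompDeterminesPoint ∧ X.InertiaDeterminesCusp ∧ X.DecompCommensurablyTerminal ∧
          X.DecompEqCommensuratorOfOpenInertia ∧ X.NoncuspidalNotLeCuspidal) ∧
      (Ω.CuspidalAbsolutenessHolds ↔ X.IsoPreservesCuspidalDecomp X) := by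
  obtain ⟨X, hK, haug, hGLD, hcusp, hnab, hslimPi, hslimD, hcpt, -⟩ :=
    exists_temperedCurve_groupLevelData_genuine p
  haveI := hcpt
  obtain ⟨h61, h63, h66⟩ := X.holds_principal_of_compactSpace
  exact ⟨X, ⟨fun Y => Y = X⟩, fun Y => Iff.rfl, hK, haug, hGLD, hcusp, hnab, hslimPi, hslimD, hcpt,
    h61, h63, h66, X.temperedDecompositionGroupsHolds_principal_iff,
    X.cuspidalAbsolutenessHolds_principal_iff⟩

/-- `Nonempty` form for the census: `TemperedOrigin p` has a producer certifying a genuine datum (not the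
empty certificate). [cite: MochizukiSemiAnbd2006, §6 p.69] -/
theorem TemperedOrigin.nonempty_certifying (p : ℕ) [Fact p.Prime] :
    ∃ Ω : TemperedOrigin p, ∃ X : TemperedCurve p, Ω.IsHyperbolicCurveOrigin X ∧ Nonempty X.GroupLevelData := by
  obtain ⟨X, Ω, hΩ, -, -, hGLD, -⟩ := TemperedOrigin.exists_principal_genuine p
  exact ⟨Ω, X, (hΩ X).mpr rfl, hGLD⟩

/-- **`TemperedMorphismOrigin p` is inhabited AT THE GENUINE MODEL**: the principal curve certificate of
abc-iut-w5-d040's `X` extended by EMPTY certificates for dominant morphisms (Thm. 6.4), `DLoc_K(X_K)`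
(Thm. 6.8 (i)(ii)) and arithmetic flags (Thm. 6.8 (iii)(iv), Cor. 6.9) — HONEST: the model
`Π^temp = G_{ℚ_p} × F̂₂` with one formal cusp is not a curve, so no such datum is certifiable there; the three
`…Holds` statements proper to this structure are therefore VACUOUS at this certificate (recorded, not
claimed as evidence), while the inherited §6 statements behave as in
`TemperedOrigin.exists_principal_genuine`. [cite: MochizukiSemiAnbd2006, §6 pp.70-75] -/
theorem TemperedMorphismOrigin.exists_principal_genuine (p : ℕ) [Fact p.Prime] :
    ∃ (X : TemperedCurve p) (Ω : TemperedMorphismOrigin p),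
      (∀ Y, Ω.IsHyperbolicCurveOrigin Y ↔ Y = X) ∧
      (∀ (Y Z : TemperedCurve p) (C : TemperedCurveHom p Y Z), ¬ Ω.IsDomHomOrigin C) ∧
      (∀ (Y : TemperedCurve p) (D : DLocContext Y), ¬ Ω.IsDLocOrigin D) ∧
      (∀ (Y : TemperedCurve p) (a : Y.CurveArithmeticFlags), ¬ Ω.IsFlagsOrigin a) ∧
      X.K = ⊥ ∧ Function.Surjective X.aug ∧ Nonempty X.GroupLevelData ∧ (∃ x : X.Pt, X.IsCusp x) ∧
      (∃ g ∈ X.DeltaTemp, ∃ h ∈ X.DeltaTemp, g * h ≠ h * g) ∧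
      IsSlimGroup X.PiTemp ∧ IsSlimGroup X.DeltaTemp ∧ CompactSpace X.PiTemp ∧
      Ω.ProfiniteNormalizersHolds ∧ Ω.DenseSubgroupsHolds ∧ Ω.ProfiniteOuterIsoLiftsHolds ∧
      -- vacuous at the empty morphism / DLoc / flag certificates:
      Ω.TemperedAnabelianTheoremHolds ∧ Ω.DLocGroupTheoreticityHolds ∧ Ω.DecompositionPreservationHolds := by
  obtain ⟨X, hK, haug, hGLD, hcusp, hnab, hslimPi, hslimD, hcpt, -⟩ :=
    exists_temperedCurve_groupLevelData_genuine p
  haveI := hcpt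
  obtain ⟨h61, h63, h66⟩ := X.holds_principal_of_compactSpace
  refine ⟨X, ⟨⟨fun Y => Y = X⟩, fun _ => False, fun _ => False, fun _ => False⟩, fun Y => Iff.rfl,
    fun _ _ _ h => h, fun _ _ h => h, fun _ _ h => h,
    hK, haug, hGLD, hcusp, hnab, hslimPi, hslimD, hcpt, h61, h63, h66, ?_, ?_, ?_⟩
  · intro Y Z C _ _ hC; exact hC.elim
  · intro Y Z DY DZ _ _ hD _; exact hD.elim
  · intro Y Z aY aZ _ _ ha _; exact ha.elim

/-! ### The once-punctured `p`-adic model of abc-iut-w5-d218: `TemperedPiOrigin ℚ_[p]` inhabited -/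

/-- **`TemperedPiOrigin ℚ_[p]` is inhabited AT THE GENUINE `p`-ADIC MODEL** (abc-iut-w5-d218,
`OncePuncturedTemperedGroup.nonempty_model_padic`: `Π = (F̂₂ ×_Ẑ ℤ) × G_{ℚ_p}`, tempered, slim, `Π ↠ ℤ`, `Δ̂`
profinite free on two generators, genuine `G_{ℚ_p}`): the PRINCIPAL certificate — `IsTateOrigin := (· = D)`
("exactly `D` is `Π^tp_X` of the Tate curve datum"), `IsOfGeometricOrigin := (· = D.toTemperedArithmeticGroup)`
— satisfies the structure's axiom `isOfGeometricOrigin_of_isTateOrigin` by `rfl`.  The [EtTh] §1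
cyclotomic statements over `TemperedPiOrigin` (`TemperedCyclotomic.lean`) thereby acquire a non-empty
certificate; their truth at the model is not addressed here. [cite: MochizukiSemiAnbd2006, Ex 3.10 pp.43-45] -/
theorem TemperedPiOrigin.exists_principal_padic (p : ℕ) [Fact p.Prime] :
    ∃ (D : OncePuncturedTemperedGroup ℚ_[p]) (Ω : TemperedPiOrigin ℚ_[p]),
      (∀ D', Ω.IsTateOrigin D' ↔ D' = D) ∧
      (∀ A, Ω.IsOfGeometricOrigin A ↔ A = D.toTemperedArithmeticGroup) ∧
      Ω.IsTateOrigin D ∧ Ω.IsOfGeometricOrigin D.toTemperedArithmeticGroup := by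
  obtain ⟨D⟩ := OncePuncturedTemperedGroup.nonempty_model_padic p
  refine ⟨D, ⟨fun A => A = D.toTemperedArithmeticGroup, fun D' => D' = D, ?_⟩,
    fun _ => Iff.rfl, fun _ => Iff.rfl, rfl, rfl⟩
  rintro D' rfl
  rfl

/-- `Nonempty` form for the census: `TemperedPiOrigin ℚ_[p]` has a producer whose Tate certificate is
non-empty. [cite: MochizukiSemiAnbd2006, Ex 3.10 p.43] -/
theorem TemperedPiOrigin.nonempty_certifying (p : ℕ) [Fact p.Prime] :
    ∃ Ω : TemperedPiOrigin ℚ_[p], ∃ D : OncePuncturedTemperedGroup ℚ_[p], Ω.IsTateOrigin D := by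
  obtain ⟨D, Ω, -, -, hD, -⟩ := TemperedPiOrigin.exists_principal_padic p
  exact ⟨Ω, D, hD⟩

end Literature.AnabelianGeometry.SemiGraphs

end
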